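/-
Copyright (c) 2026. All rights reserved.
Released under Apache 2.0 license as described in the file LICENSE.
Authors: HodgeCM publication cell (pub-hodgecm), GR lane, seat GR-2 (`pub-hodgecm-own-hyp34`).
-/
import Literature.NumberTheory.GelbartRogawski1991.Prop311PrintedDarbouxLegs
import Literature.NumberTheory.GelbartRogawski1991.Prop311PrintedMpContinuity
import HarnessLib

-- build-lane note (ops-buildfix G11b-3 recipe): dependent telescopes of the CM dual-pair datum; elaborate sequentially.
set_option Elab.async false

/-!
# [GelbartRogawski1991, Prop. 3.1.1] AS PRINTED: transport of `Mp` legs — along a change of adelic Darboux frame, and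
# along a change of model of `ρ_ψ`

Topic `NumberTheory/GelbartRogawski1991`; namespace `Literature.NumberTheory.GelbartRogawski1991.Prop311`.  KERNEL ONLY:
proved lemmas about the input predicate `DarbouxLegs` of `Prop311PrintedDarbouxLegs` (the comparison of print's
Hilbert-space `Mp_𝐀(W)` with the tree's smooth metaplectic group `Weil1964.adelicMpCont F (Fin n) 1` over the adelic
Darboux frames); no definition, no named fact, nothing of [GelbartRogawski1991] or [Weil1964] is asserted;
`Prop311AsPrinted` is untouched.

`DarbouxLegs F E V Φ ρ n` asks for a continuous leg over EVERY adelic Darboux frame `e : 𝐀ⁿ × 𝐀ⁿ ≃ W_𝐀`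
(`φ_𝐀(e c, e c') = c.1 ⬝ᵥ c'.2 - c'.1 ⬝ᵥ c.2`).  This file shows how legs move:

* §1 **`frameChange_mem_symplecticGroup`**: two adelic Darboux frames `e₀, e` differ by an element `e₀⁻¹ ∘ e` of the
  standard adelic symplectic group `Sp(𝐀ⁿ × 𝐀ⁿ, std)` (`symplecticGroup (polar (adelicForm F (Fin n) 1))`);
* §2 **`exists_darbouxLeg_of_lift`**: a continuous leg `φ₀` over `e₀` and a LIFT `q ∈ Mp_ψ(𝐀ⁿ × 𝐀ⁿ, std)ᶜᵒⁿᵗ` of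
  `e₀⁻¹ ∘ e` (`π₁(q) = e₀⁻¹ ∘ e`) give the continuous leg `m ↦ φ₀(q m q⁻¹)` over `e` (continuity: conjugation by the
  pair `φ₀(q)` is continuous in print's topology, `Prop311PrintedMpContinuity.continuous_conj`); hence
  **`darbouxLegs_of_darbouxLeg_of_proj_surjective`**: if `π₁ : Mp_ψ(𝐀ⁿ × 𝐀ⁿ, std)ᶜᵒⁿᵗ → Sp(𝐀ⁿ × 𝐀ⁿ, std)` is onto
  ([Weil1964, Chap. III n° 37–39]: every adelic symplectic automorphism is implemented — NOT supplied by this file, an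
  explicit hypothesis), ONE continuous leg over ONE Darboux frame gives `DarbouxLegs`; and the CM capstone
  **`prop311_CM_of_darbouxLeg_of_proj_surjective`** (= `Prop311PrintedDarbouxLegs.prop311_CM_of_darbouxLegs` then);
* §3 **`darbouxLegs_of_monoidHom`** / **`exists_darbouxLeg_of_monoidHom`**: a continuous homomorphism
  `Ψ : Mp_𝐀(W)_{ρ'} → Mp_𝐀(W)_ρ` over `Sp_𝐀(W)` (the shape produced from a unitary intertwiner of two printed models,
  [MoeglinVignerasWaldspurger1987, Chap. 2 II.1 (B)]) carries legs for `ρ'` to legs for `ρ`: `DarbouxLegs ρ' → DarbouxLegs ρ`.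
  So legs for ONE printed model of `ρ_ψ` give legs — and, by `prop311_CM_of_darbouxLegs`, the printed proposition at
  CM data — for EVERY printed model.

## References
* [GelbartRogawski1991] S. Gelbart, J. Rogawski, Invent. Math. 105 (1991) 445–472, §3.1 p. 454 L17–36, Prop. 3.1.1
  p. 455 L1–2.
* [Weil1964] A. Weil, Acta Math. 111 (1964) 143–211, Chap. III n° 37–40.
* [MoeglinVignerasWaldspurger1987] C. Mœglin, M.-F. Vignéras, J.-L. Waldspurger, LNM 1291 (1987), Chap. 2 II.1 (B).
-/

set_option autoImplicit false

noncomputable section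

open NumberField
open scoped TensorProduct Matrix
open Literature.NumberTheory.Automorphic
open Literature.RepresentationTheory.HeisenbergGroup
open Literature.NumberTheory.Weil1964

namespace Literature.NumberTheory.GelbartRogawski1991

namespace Prop311

/-! ## §1. Two adelic Darboux frames differ by a standard symplectic automorphism -/

section Frames

variable (F : Type) [Field F] [NumberField F]
variable (E : Type) [Field E] [Algebra F E]
variable (V : Type) [AddCommGroup V] [Module F V]
variable (Φ : V →ₗ[F] V →ₗ[F] E)

/-- **change of adelic Darboux frame**: if `e₀, e : 𝐀ⁿ × 𝐀ⁿ ≃ W_𝐀` are both Darboux for `φ_𝐀 = Tr(Φ) ⊗ 𝐀`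
(`φ_𝐀(e c, e c') = c.1 ⬝ᵥ c'.2 - c'.1 ⬝ᵥ c.2`), then `e₀⁻¹ ∘ e` preserves the standard alternating form, i.e. lies in
`Sp(𝐀ⁿ × 𝐀ⁿ, std) = symplecticGroup (polar (adelicForm F (Fin n) 1))`, the symplectic group of the tree's smooth model.
[cite: GelbartRogawski1991, §3.1 p. 454 L17–22; Weil1964, Chap. I n° 4–5] -/
theorem frameChange_mem_symplecticGroup (n : ℕ)
    (e₀ e : ((Fin n → AdeleRing (𝓞 F) F) × (Fin n → AdeleRing (𝓞 F) F)) ≃ₗ[AdeleRing (𝓞 F) F] AdelicSpace F V)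
    (he₀ : ∀ c c' : (Fin n → AdeleRing (𝓞 F) F) × (Fin n → AdeleRing (𝓞 F) F),
      adelicTraceForm F E V Φ (e₀ c) (e₀ c') = c.1 ⬝ᵥ c'.2 - c'.1 ⬝ᵥ c.2)
    (he : ∀ c c' : (Fin n → AdeleRing (𝓞 F) F) × (Fin n → AdeleRing (𝓞 F) F),
      adelicTraceForm F E V Φ (e c) (e c') = c.1 ⬝ᵥ c'.2 - c'.1 ⬝ᵥ c.2) :
    e.trans e₀.symm ∈ symplecticGroup (polar (adelicForm F (Fin n)
      (1 : Matrix (Fin n) (Fin n) (AdeleRing (𝓞 F) F)))) := by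
  rw [mem_symplecticGroup]
  intro w w'
  simp only [polar_apply, adelicForm_apply, Matrix.one_mulVec, LinearEquiv.trans_apply]
  rw [← he₀, LinearEquiv.apply_symm_apply, LinearEquiv.apply_symm_apply, he]

end Frames

/-! ## §2. Legs move along a lift of the frame change -/

section Lift

variable (F : Type) [Field F] [NumberField F]
variable (E : Type) [Field E] [Algebra F E]
variable (V : Type) [AddCommGroup V] [Module F V]
variable (Φ : V →ₗ[F] V →ₗ[F] E)
variable {S : Type} [NormedAddCommGroup S] [InnerProductSpace ℂ S]
variable (ρ : Representation ℂ (AdelicHeisenberg F E V Φ) S)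

/-- **a leg over `e₀` and a lift of `e₀⁻¹ ∘ e` give a leg over `e`.**  Let `φ₀ : Mp_ψ(𝐀ⁿ × 𝐀ⁿ, std)ᶜᵒⁿᵗ → Mp_𝐀(W)` be
a continuous homomorphism over the frame `e₀` (`π(φ₀ m) ∘ e₀ = e₀ ∘ π₁(m)`) and `q ∈ Mp_ψ(𝐀ⁿ × 𝐀ⁿ, std)ᶜᵒⁿᵗ` with
`π₁(q) = e₀⁻¹ ∘ e`.  Then `m ↦ φ₀(q m q⁻¹)` is a continuous homomorphism over `e` (continuity by
`Prop311PrintedMpContinuity.continuous_conj` at the pair `φ₀(q)`).  No Darboux hypothesis is needed for this step.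
[cite: GelbartRogawski1991, §3.1 p. 454 L21–30; Weil1964, Chap. III n° 39] -/
theorem exists_darbouxLeg_of_lift (n : ℕ)
    (e₀ e : ((Fin n → AdeleRing (𝓞 F) F) × (Fin n → AdeleRing (𝓞 F) F)) ≃ₗ[AdeleRing (𝓞 F) F] AdelicSpace F V)
    (φ₀ : adelicMpCont F (Fin n) (1 : Matrix (Fin n) (Fin n) (AdeleRing (𝓞 F) F)) →* adelicMp F E V Φ ρ)
    (hφ₀ : Continuous φ₀)
    (hproj₀ : ∀ (m₁ : adelicMpCont F (Fin n) (1 : Matrix (Fin n) (Fin n) (AdeleRing (𝓞 F) F)))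
        (c : (Fin n → AdeleRing (𝓞 F) F) × (Fin n → AdeleRing (𝓞 F) F)),
      ((proj F E V Φ ρ (φ₀ m₁) : adelicSp F E V Φ) :
          AdelicSpace F V ≃ₗ[AdeleRing (𝓞 F) F] AdelicSpace F V) (e₀ c) =
        e₀ (((adelicMpCont.proj F (Fin n) (1 : Matrix (Fin n) (Fin n) (AdeleRing (𝓞 F) F)) m₁ :
              symplecticGroup (polar (adelicForm F (Fin n) (1 : Matrix (Fin n) (Fin n) (AdeleRing (𝓞 F) F))))) :
            ((Fin n → AdeleRing (𝓞 F) F) × (Fin n → AdeleRing (𝓞 F) F)) ≃ₗ[AdeleRing (𝓞 F) F]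
              ((Fin n → AdeleRing (𝓞 F) F) × (Fin n → AdeleRing (𝓞 F) F))) c))
    (q : adelicMpCont F (Fin n) (1 : Matrix (Fin n) (Fin n) (AdeleRing (𝓞 F) F)))
    (hq : ∀ c : (Fin n → AdeleRing (𝓞 F) F) × (Fin n → AdeleRing (𝓞 F) F),
      ((adelicMpCont.proj F (Fin n) (1 : Matrix (Fin n) (Fin n) (AdeleRing (𝓞 F) F)) q :
            symplecticGroup (polar (adelicForm F (Fin n) (1 : Matrix (Fin n) (Fin n) (AdeleRing (𝓞 F) F))))) :
          ((Fin n → AdeleRing (𝓞 F) F) × (Fin n → AdeleRing (𝓞 F) F)) ≃ₗ[AdeleRing (𝓞 F) F]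
            ((Fin n → AdeleRing (𝓞 F) F) × (Fin n → AdeleRing (𝓞 F) F))) c = e₀.symm (e c)) :
    ∃ φ₁ : adelicMpCont F (Fin n) (1 : Matrix (Fin n) (Fin n) (AdeleRing (𝓞 F) F)) →* adelicMp F E V Φ ρ,
      Continuous φ₁ ∧
        ∀ (m₁ : adelicMpCont F (Fin n) (1 : Matrix (Fin n) (Fin n) (AdeleRing (𝓞 F) F)))
          (c : (Fin n → AdeleRing (𝓞 F) F) × (Fin n → AdeleRing (𝓞 F) F)),
          ((proj F E V Φ ρ (φ₁ m₁) : adelicSp F E V Φ) :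
              AdelicSpace F V ≃ₗ[AdeleRing (𝓞 F) F] AdelicSpace F V) (e c) =
            e (((adelicMpCont.proj F (Fin n) (1 : Matrix (Fin n) (Fin n) (AdeleRing (𝓞 F) F)) m₁ :
                  symplecticGroup (polar (adelicForm F (Fin n)
                    (1 : Matrix (Fin n) (Fin n) (AdeleRing (𝓞 F) F))))) :
                ((Fin n → AdeleRing (𝓞 F) F) × (Fin n → AdeleRing (𝓞 F) F)) ≃ₗ[AdeleRing (𝓞 F) F]
                  ((Fin n → AdeleRing (𝓞 F) F) × (Fin n → AdeleRing (𝓞 F) F))) c) := by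
  refine ⟨φ₀.comp (MulAut.conj q).toMonoidHom, ?_, fun m₁ c => ?_⟩
  · have h : (fun m => (φ₀.comp (MulAut.conj q).toMonoidHom) m) = fun m => φ₀ q * φ₀ m * (φ₀ q)⁻¹ := by
      funext m
      simp only [MonoidHom.comp_apply, MulEquiv.coe_toMonoidHom, MulAut.conj_apply, map_mul, map_inv]
    show Continuous fun m => (φ₀.comp (MulAut.conj q).toMonoidHom) m
    rw [h]
    exact (continuous_conj F E V Φ ρ (φ₀ q)).comp hφ₀
  · -- No `rw`/`exact` that would compare two DIFFERENT values of `adelicMpCont.proj` at default transparency (the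
    -- projection unfolds into the Schrödinger model and times out): `simp only` (reducible matching) and congruences.
    have h1 : e c = e₀ (((adelicMpCont.proj F (Fin n) (1 : Matrix (Fin n) (Fin n) (AdeleRing (𝓞 F) F)) q :
          symplecticGroup (polar (adelicForm F (Fin n) (1 : Matrix (Fin n) (Fin n) (AdeleRing (𝓞 F) F))))) :
          ((Fin n → AdeleRing (𝓞 F) F) × (Fin n → AdeleRing (𝓞 F) F)) ≃ₗ[AdeleRing (𝓞 F) F]
            ((Fin n → AdeleRing (𝓞 F) F) × (Fin n → AdeleRing (𝓞 F) F))) c) :=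
      ((e₀.apply_symm_apply (e c)).symm.trans (congrArg (fun x => e₀ x) (hq c)).symm)
    have h3 := hproj₀ (q * m₁ * q⁻¹)
      (((adelicMpCont.proj F (Fin n) (1 : Matrix (Fin n) (Fin n) (AdeleRing (𝓞 F) F)) q :
          symplecticGroup (polar (adelicForm F (Fin n) (1 : Matrix (Fin n) (Fin n) (AdeleRing (𝓞 F) F))))) :
          ((Fin n → AdeleRing (𝓞 F) F) × (Fin n → AdeleRing (𝓞 F) F)) ≃ₗ[AdeleRing (𝓞 F) F]
            ((Fin n → AdeleRing (𝓞 F) F) × (Fin n → AdeleRing (𝓞 F) F))) c)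
    have hm : adelicMpCont.proj F (Fin n) (1 : Matrix (Fin n) (Fin n) (AdeleRing (𝓞 F) F)) (q * m₁ * q⁻¹) =
        adelicMpCont.proj F (Fin n) (1 : Matrix (Fin n) (Fin n) (AdeleRing (𝓞 F) F)) q *
          adelicMpCont.proj F (Fin n) (1 : Matrix (Fin n) (Fin n) (AdeleRing (𝓞 F) F)) m₁ *
          (adelicMpCont.proj F (Fin n) (1 : Matrix (Fin n) (Fin n) (AdeleRing (𝓞 F) F)) q)⁻¹ := by
      simp only [map_mul, map_inv]
    have h4 : ((adelicMpCont.proj F (Fin n) (1 : Matrix (Fin n) (Fin n) (AdeleRing (𝓞 F) F)) (q * m₁ * q⁻¹) :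
          symplecticGroup (polar (adelicForm F (Fin n) (1 : Matrix (Fin n) (Fin n) (AdeleRing (𝓞 F) F))))) :
          ((Fin n → AdeleRing (𝓞 F) F) × (Fin n → AdeleRing (𝓞 F) F)) ≃ₗ[AdeleRing (𝓞 F) F]
            ((Fin n → AdeleRing (𝓞 F) F) × (Fin n → AdeleRing (𝓞 F) F)))
          (((adelicMpCont.proj F (Fin n) (1 : Matrix (Fin n) (Fin n) (AdeleRing (𝓞 F) F)) q :
            symplecticGroup (polar (adelicForm F (Fin n) (1 : Matrix (Fin n) (Fin n) (AdeleRing (𝓞 F) F))))) :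
            ((Fin n → AdeleRing (𝓞 F) F) × (Fin n → AdeleRing (𝓞 F) F)) ≃ₗ[AdeleRing (𝓞 F) F]
              ((Fin n → AdeleRing (𝓞 F) F) × (Fin n → AdeleRing (𝓞 F) F))) c) =
        ((adelicMpCont.proj F (Fin n) (1 : Matrix (Fin n) (Fin n) (AdeleRing (𝓞 F) F)) q :
          symplecticGroup (polar (adelicForm F (Fin n) (1 : Matrix (Fin n) (Fin n) (AdeleRing (𝓞 F) F))))) :
          ((Fin n → AdeleRing (𝓞 F) F) × (Fin n → AdeleRing (𝓞 F) F)) ≃ₗ[AdeleRing (𝓞 F) F]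
            ((Fin n → AdeleRing (𝓞 F) F) × (Fin n → AdeleRing (𝓞 F) F)))
          (((adelicMpCont.proj F (Fin n) (1 : Matrix (Fin n) (Fin n) (AdeleRing (𝓞 F) F)) m₁ :
            symplecticGroup (polar (adelicForm F (Fin n) (1 : Matrix (Fin n) (Fin n) (AdeleRing (𝓞 F) F))))) :
            ((Fin n → AdeleRing (𝓞 F) F) × (Fin n → AdeleRing (𝓞 F) F)) ≃ₗ[AdeleRing (𝓞 F) F]
              ((Fin n → AdeleRing (𝓞 F) F) × (Fin n → AdeleRing (𝓞 F) F))) c) := by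
      simp only [hm, Subgroup.coe_mul, Subgroup.coe_inv, LinearEquiv.mul_apply, LinearEquiv.coe_inv,
        LinearEquiv.symm_apply_apply]
    have h6 : e₀ (((adelicMpCont.proj F (Fin n) (1 : Matrix (Fin n) (Fin n) (AdeleRing (𝓞 F) F)) q :
          symplecticGroup (polar (adelicForm F (Fin n) (1 : Matrix (Fin n) (Fin n) (AdeleRing (𝓞 F) F))))) :
          ((Fin n → AdeleRing (𝓞 F) F) × (Fin n → AdeleRing (𝓞 F) F)) ≃ₗ[AdeleRing (𝓞 F) F]
            ((Fin n → AdeleRing (𝓞 F) F) × (Fin n → AdeleRing (𝓞 F) F)))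
          (((adelicMpCont.proj F (Fin n) (1 : Matrix (Fin n) (Fin n) (AdeleRing (𝓞 F) F)) m₁ :
            symplecticGroup (polar (adelicForm F (Fin n) (1 : Matrix (Fin n) (Fin n) (AdeleRing (𝓞 F) F))))) :
            ((Fin n → AdeleRing (𝓞 F) F) × (Fin n → AdeleRing (𝓞 F) F)) ≃ₗ[AdeleRing (𝓞 F) F]
              ((Fin n → AdeleRing (𝓞 F) F) × (Fin n → AdeleRing (𝓞 F) F))) c)) =
        e (((adelicMpCont.proj F (Fin n) (1 : Matrix (Fin n) (Fin n) (AdeleRing (𝓞 F) F)) m₁ :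
          symplecticGroup (polar (adelicForm F (Fin n) (1 : Matrix (Fin n) (Fin n) (AdeleRing (𝓞 F) F))))) :
          ((Fin n → AdeleRing (𝓞 F) F) × (Fin n → AdeleRing (𝓞 F) F)) ≃ₗ[AdeleRing (𝓞 F) F]
            ((Fin n → AdeleRing (𝓞 F) F) × (Fin n → AdeleRing (𝓞 F) F))) c) :=
      (congrArg (fun x => e₀ x) (hq
        (((adelicMpCont.proj F (Fin n) (1 : Matrix (Fin n) (Fin n) (AdeleRing (𝓞 F) F)) m₁ :
          symplecticGroup (polar (adelicForm F (Fin n) (1 : Matrix (Fin n) (Fin n) (AdeleRing (𝓞 F) F))))) :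
          ((Fin n → AdeleRing (𝓞 F) F) × (Fin n → AdeleRing (𝓞 F) F)) ≃ₗ[AdeleRing (𝓞 F) F]
            ((Fin n → AdeleRing (𝓞 F) F) × (Fin n → AdeleRing (𝓞 F) F))) c))).trans (e₀.apply_symm_apply _)
    have hA : ((proj F E V Φ ρ ((φ₀.comp (MulAut.conj q).toMonoidHom) m₁) : adelicSp F E V Φ) :
          AdelicSpace F V ≃ₗ[AdeleRing (𝓞 F) F] AdelicSpace F V) (e c) =
        ((proj F E V Φ ρ (φ₀ (q * m₁ * q⁻¹)) : adelicSp F E V Φ) :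
          AdelicSpace F V ≃ₗ[AdeleRing (𝓞 F) F] AdelicSpace F V)
          (e₀ (((adelicMpCont.proj F (Fin n) (1 : Matrix (Fin n) (Fin n) (AdeleRing (𝓞 F) F)) q :
            symplecticGroup (polar (adelicForm F (Fin n) (1 : Matrix (Fin n) (Fin n) (AdeleRing (𝓞 F) F))))) :
            ((Fin n → AdeleRing (𝓞 F) F) × (Fin n → AdeleRing (𝓞 F) F)) ≃ₗ[AdeleRing (𝓞 F) F]
              ((Fin n → AdeleRing (𝓞 F) F) × (Fin n → AdeleRing (𝓞 F) F))) c)) :=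
      congrArg (fun w : AdelicSpace F V => ((proj F E V Φ ρ (φ₀ (q * m₁ * q⁻¹)) : adelicSp F E V Φ) :
          AdelicSpace F V ≃ₗ[AdeleRing (𝓞 F) F] AdelicSpace F V) w) h1
    exact hA.trans (h3.trans ((congrArg (fun x => e₀ x) h4).trans h6))

/-- **ONE leg gives all the legs when `π₁` is onto.**  If `π₁ : Mp_ψ(𝐀ⁿ × 𝐀ⁿ, std)ᶜᵒⁿᵗ → Sp(𝐀ⁿ × 𝐀ⁿ, std)` is
surjective (every adelic symplectic automorphism has an LF-continuous implementer on `𝒮(𝐀ⁿ)` — [Weil1964, Chap. III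
n° 37–39]; an explicit HYPOTHESIS here, not supplied), then a continuous leg over ONE adelic Darboux frame `e₀` yields
`DarbouxLegs F E V Φ ρ n` (a leg over every Darboux frame: lift `e₀⁻¹ ∘ e ∈ Sp(𝐀ⁿ × 𝐀ⁿ, std)`,
`frameChange_mem_symplecticGroup`, and conjugate, `exists_darbouxLeg_of_lift`).
[cite: GelbartRogawski1991, §3.1 p. 454 L21–30; Weil1964, Chap. III n° 37–39] -/
theorem darbouxLegs_of_darbouxLeg_of_proj_surjective (n : ℕ)
    (hsurj : Function.Surjective (adelicMpCont.proj F (Fin n) (1 : Matrix (Fin n) (Fin n) (AdeleRing (𝓞 F) F))))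
    (e₀ : ((Fin n → AdeleRing (𝓞 F) F) × (Fin n → AdeleRing (𝓞 F) F)) ≃ₗ[AdeleRing (𝓞 F) F] AdelicSpace F V)
    (he₀ : ∀ c c' : (Fin n → AdeleRing (𝓞 F) F) × (Fin n → AdeleRing (𝓞 F) F),
      adelicTraceForm F E V Φ (e₀ c) (e₀ c') = c.1 ⬝ᵥ c'.2 - c'.1 ⬝ᵥ c.2)
    (φ₀ : adelicMpCont F (Fin n) (1 : Matrix (Fin n) (Fin n) (AdeleRing (𝓞 F) F)) →* adelicMp F E V Φ ρ)
    (hφ₀ : Continuous φ₀)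
    (hproj₀ : ∀ (m₁ : adelicMpCont F (Fin n) (1 : Matrix (Fin n) (Fin n) (AdeleRing (𝓞 F) F)))
        (c : (Fin n → AdeleRing (𝓞 F) F) × (Fin n → AdeleRing (𝓞 F) F)),
      ((proj F E V Φ ρ (φ₀ m₁) : adelicSp F E V Φ) :
          AdelicSpace F V ≃ₗ[AdeleRing (𝓞 F) F] AdelicSpace F V) (e₀ c) =
        e₀ (((adelicMpCont.proj F (Fin n) (1 : Matrix (Fin n) (Fin n) (AdeleRing (𝓞 F) F)) m₁ :
              symplecticGroup (polar (adelicForm F (Fin n) (1 : Matrix (Fin n) (Fin n) (AdeleRing (𝓞 F) F))))) :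
            ((Fin n → AdeleRing (𝓞 F) F) × (Fin n → AdeleRing (𝓞 F) F)) ≃ₗ[AdeleRing (𝓞 F) F]
              ((Fin n → AdeleRing (𝓞 F) F) × (Fin n → AdeleRing (𝓞 F) F))) c)) :
    DarbouxLegs F E V Φ ρ n := by
  intro e he
  have hmem := frameChange_mem_symplecticGroup F E V Φ n e₀ e he₀ he
  have hlift := hsurj ⟨e.trans e₀.symm, hmem⟩
  obtain ⟨q, hq⟩ := hlift
  have hq' : ∀ c : (Fin n → AdeleRing (𝓞 F) F) × (Fin n → AdeleRing (𝓞 F) F),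
      ((adelicMpCont.proj F (Fin n) (1 : Matrix (Fin n) (Fin n) (AdeleRing (𝓞 F) F)) q :
            symplecticGroup (polar (adelicForm F (Fin n) (1 : Matrix (Fin n) (Fin n) (AdeleRing (𝓞 F) F))))) :
          ((Fin n → AdeleRing (𝓞 F) F) × (Fin n → AdeleRing (𝓞 F) F)) ≃ₗ[AdeleRing (𝓞 F) F]
            ((Fin n → AdeleRing (𝓞 F) F) × (Fin n → AdeleRing (𝓞 F) F))) c = e₀.symm (e c) := fun c => by
    rw [hq]
    rfl
  exact exists_darbouxLeg_of_lift F E V Φ ρ n e₀ e φ₀ hφ₀ hproj₀ q hq'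

end Lift

/-! ## §3. Legs move along a homomorphism of printed models over `Sp_𝐀(W)` -/

section Model

variable (F : Type) [Field F] [NumberField F]
variable (E : Type) [Field E] [Algebra F E]
variable (V : Type) [AddCommGroup V] [Module F V]
variable (Φ : V →ₗ[F] V →ₗ[F] E)
variable {S : Type} [NormedAddCommGroup S] [InnerProductSpace ℂ S]
variable {S' : Type} [NormedAddCommGroup S'] [InnerProductSpace ℂ S']
variable (ρ : Representation ℂ (AdelicHeisenberg F E V Φ) S) (ρ' : Representation ℂ (AdelicHeisenberg F E V Φ) S')

/-- **a leg for one model gives a leg for another, along a continuous homomorphism over `Sp_𝐀(W)`**: if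
`Ψ : Mp_𝐀(W)_{ρ'} → Mp_𝐀(W)_ρ` is a continuous homomorphism with `π ∘ Ψ = π` (e.g. `(g, M) ↦ (g, U M U⁻¹)` for a unitary
intertwiner `U` of the two printed models), a continuous leg over a frame `e` for `ρ'` composes to one for `ρ`.
[cite: MoeglinVignerasWaldspurger1987, Chap. 2 II.1 (B); GelbartRogawski1991, §3.1 p. 454 L19–27] -/
theorem exists_darbouxLeg_of_monoidHom (Ψ : adelicMp F E V Φ ρ' →* adelicMp F E V Φ ρ) (hΨc : Continuous Ψ)
    (hΨπ : ∀ p, proj F E V Φ ρ (Ψ p) = proj F E V Φ ρ' p) (n : ℕ)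
    (e : ((Fin n → AdeleRing (𝓞 F) F) × (Fin n → AdeleRing (𝓞 F) F)) ≃ₗ[AdeleRing (𝓞 F) F] AdelicSpace F V)
    (φ₁' : adelicMpCont F (Fin n) (1 : Matrix (Fin n) (Fin n) (AdeleRing (𝓞 F) F)) →* adelicMp F E V Φ ρ')
    (hφ₁' : Continuous φ₁')
    (hproj₁' : ∀ (m₁ : adelicMpCont F (Fin n) (1 : Matrix (Fin n) (Fin n) (AdeleRing (𝓞 F) F)))
        (c : (Fin n → AdeleRing (𝓞 F) F) × (Fin n → AdeleRing (𝓞 F) F)),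
      ((proj F E V Φ ρ' (φ₁' m₁) : adelicSp F E V Φ) :
          AdelicSpace F V ≃ₗ[AdeleRing (𝓞 F) F] AdelicSpace F V) (e c) =
        e (((adelicMpCont.proj F (Fin n) (1 : Matrix (Fin n) (Fin n) (AdeleRing (𝓞 F) F)) m₁ :
              symplecticGroup (polar (adelicForm F (Fin n) (1 : Matrix (Fin n) (Fin n) (AdeleRing (𝓞 F) F))))) :
            ((Fin n → AdeleRing (𝓞 F) F) × (Fin n → AdeleRing (𝓞 F) F)) ≃ₗ[AdeleRing (𝓞 F) F]
              ((Fin n → AdeleRing (𝓞 F) F) × (Fin n → AdeleRing (𝓞 F) F))) c)) :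
    ∃ φ₁ : adelicMpCont F (Fin n) (1 : Matrix (Fin n) (Fin n) (AdeleRing (𝓞 F) F)) →* adelicMp F E V Φ ρ,
      Continuous φ₁ ∧
        ∀ (m₁ : adelicMpCont F (Fin n) (1 : Matrix (Fin n) (Fin n) (AdeleRing (𝓞 F) F)))
          (c : (Fin n → AdeleRing (𝓞 F) F) × (Fin n → AdeleRing (𝓞 F) F)),
          ((proj F E V Φ ρ (φ₁ m₁) : adelicSp F E V Φ) :
              AdelicSpace F V ≃ₗ[AdeleRing (𝓞 F) F] AdelicSpace F V) (e c) =
            e (((adelicMpCont.proj F (Fin n) (1 : Matrix (Fin n) (Fin n) (AdeleRing (𝓞 F) F)) m₁ :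
                  symplecticGroup (polar (adelicForm F (Fin n)
                    (1 : Matrix (Fin n) (Fin n) (AdeleRing (𝓞 F) F))))) :
                ((Fin n → AdeleRing (𝓞 F) F) × (Fin n → AdeleRing (𝓞 F) F)) ≃ₗ[AdeleRing (𝓞 F) F]
                  ((Fin n → AdeleRing (𝓞 F) F) × (Fin n → AdeleRing (𝓞 F) F))) c) := by
  refine ⟨Ψ.comp φ₁', hΨc.comp hφ₁', fun m₁ c => ?_⟩
  -- (no `rw` in the large goal: a congruence along `π ∘ Ψ = π` instead)
  have h2 : proj F E V Φ ρ ((Ψ.comp φ₁') m₁) = proj F E V Φ ρ' (φ₁' m₁) := hΨπ (φ₁' m₁)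
  exact (congrArg (fun g : adelicSp F E V Φ =>
    (g : AdelicSpace F V ≃ₗ[AdeleRing (𝓞 F) F] AdelicSpace F V) (e c)) h2).trans (hproj₁' m₁ c)

/-- **`DarbouxLegs` is carried along a continuous homomorphism of printed models over `Sp_𝐀(W)`**: legs for ONE printed
model of `ρ_ψ` give legs for every model reached by such a `Ψ` (two printed models are related by a unitary intertwiner,
"`ρ_ψ` is unique up to isomorphism", p. 454 L20–21, which induces `Ψ`).
[cite: MoeglinVignerasWaldspurger1987, Chap. 2 II.1 (B); GelbartRogawski1991, §3.1 p. 454 L19–27] -/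
theorem darbouxLegs_of_monoidHom (Ψ : adelicMp F E V Φ ρ' →* adelicMp F E V Φ ρ) (hΨc : Continuous Ψ)
    (hΨπ : ∀ p, proj F E V Φ ρ (Ψ p) = proj F E V Φ ρ' p) (n : ℕ) (legs' : DarbouxLegs F E V Φ ρ' n) :
    DarbouxLegs F E V Φ ρ n := by
  intro e he
  have hleg := legs' e he
  obtain ⟨φ₁', hφ₁', hproj₁'⟩ := hleg
  exact exists_darbouxLeg_of_monoidHom F E V Φ ρ ρ' Ψ hΨc hΨπ n e φ₁' hφ₁' hproj₁'

end Model

/-! ## §4. The CM capstone with one leg and `π₁` onto -/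

section CM

variable (L : Type) [Field L] [NumberField L] [IsCMField L]
variable {n : ℕ}
-- `V` an `L`-space; its `L⁺`-structure is Mathlib's restriction (no separate binder).
variable (V : Type) [AddCommGroup V] [Module L V] [FiniteDimensional L V]
variable (Φ : V →ₗ[↥(maximalRealSubfield L)] V →ₗ[↥(maximalRealSubfield L)] L)
variable {S : Type} [NormedAddCommGroup S] [InnerProductSpace ℂ S] [CompleteSpace S]
variable (ρ : Representation ℂ (AdelicHeisenberg (↥(maximalRealSubfield L)) L V Φ) S)

/-- **[We] + [GelbartRogawski1991, Prop. 3.1.1] AS PRINTED AT CM DATA from ONE leg over ONE adelic Darboux frame, when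
`π₁` is onto.**  `L` a CM field, `F = L⁺`, `E = L`, `σ` = complex conjugation; binders of `Prop311AsPrinted` at these
parameters (`(V, Φ)` skew-Hermitian of `E`-dimension `n`, `φ = Tr Φ` non-degenerate, `ρ` isometric and irreducible);
`π₁ : Mp_ψ(𝐀ⁿ × 𝐀ⁿ, std)ᶜᵒⁿᵗ → Sp(𝐀ⁿ × 𝐀ⁿ, std)` surjective (hypothesis); ONE continuous leg `φ₀` over ONE
adelic Darboux frame `e₀` of `φ_𝐀`.  Then (a) `π` has exactly one rational splitting `i`, and (b) for every rational splitting `i` the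
conclusion (1) ∧ (2) of Prop. 3.1.1 holds verbatim (`darbouxLegs_of_darbouxLeg_of_proj_surjective` +
`prop311_CM_of_darbouxLegs`). [cite: GelbartRogawski1991, §3.1 p. 454 L17–42; Prop. 3.1.1 p. 455 L1–2] -/
theorem prop311_CM_of_darbouxLeg_of_proj_surjective (hn : Module.finrank L V = n)
    (hΦ₁ : ∀ (a : L) (x y : V), Φ (a • x) y = a * Φ x y)
    (hΦ₂ : ∀ (a : L) (x y : V), Φ x (a • y) = Φ x y * IsCMField.complexConj L a)
    (hΦ₃ : ∀ x y : V, Φ y x = -IsCMField.complexConj L (Φ x y))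
    (hφ : (traceForm (↥(maximalRealSubfield L)) L V Φ).Nondegenerate)
    (hρu : ∀ (h : AdelicHeisenberg (↥(maximalRealSubfield L)) L V Φ) (v : S), ‖ρ h v‖ = ‖v‖)
    (hρi : ∀ K : Submodule ℂ S, IsClosed (K : Set S) →
      (∀ (h : AdelicHeisenberg (↥(maximalRealSubfield L)) L V Φ), ∀ v ∈ K, ρ h v ∈ K) → K = ⊥ ∨ K = ⊤)
    (hsurj : Function.Surjective (adelicMpCont.proj (↥(maximalRealSubfield L)) (Fin n)
      (1 : Matrix (Fin n) (Fin n) (AdeleRing (𝓞 ↥(maximalRealSubfield L)) ↥(maximalRealSubfield L)))))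
    (e₀ : ((Fin n → AdeleRing (𝓞 ↥(maximalRealSubfield L)) ↥(maximalRealSubfield L)) ×
        (Fin n → AdeleRing (𝓞 ↥(maximalRealSubfield L)) ↥(maximalRealSubfield L))) ≃ₗ[
          AdeleRing (𝓞 ↥(maximalRealSubfield L)) ↥(maximalRealSubfield L)] AdelicSpace (↥(maximalRealSubfield L)) V)
    (he₀ : ∀ c c' : (Fin n → AdeleRing (𝓞 ↥(maximalRealSubfield L)) ↥(maximalRealSubfield L)) ×
        (Fin n → AdeleRing (𝓞 ↥(maximalRealSubfield L)) ↥(maximalRealSubfield L)),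
      adelicTraceForm (↥(maximalRealSubfield L)) L V Φ (e₀ c) (e₀ c') = c.1 ⬝ᵥ c'.2 - c'.1 ⬝ᵥ c.2)
    (φ₀ : adelicMpCont (↥(maximalRealSubfield L)) (Fin n)
        (1 : Matrix (Fin n) (Fin n) (AdeleRing (𝓞 ↥(maximalRealSubfield L)) ↥(maximalRealSubfield L))) →*
      adelicMp (↥(maximalRealSubfield L)) L V Φ ρ) (hφ₀ : Continuous φ₀)
    (hproj₀ : ∀ (m₁ : adelicMpCont (↥(maximalRealSubfield L)) (Fin n)
          (1 : Matrix (Fin n) (Fin n) (AdeleRing (𝓞 ↥(maximalRealSubfield L)) ↥(maximalRealSubfield L))))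
        (c : (Fin n → AdeleRing (𝓞 ↥(maximalRealSubfield L)) ↥(maximalRealSubfield L)) ×
          (Fin n → AdeleRing (𝓞 ↥(maximalRealSubfield L)) ↥(maximalRealSubfield L))),
      ((proj (↥(maximalRealSubfield L)) L V Φ ρ (φ₀ m₁) : adelicSp (↥(maximalRealSubfield L)) L V Φ) :
            AdelicSpace (↥(maximalRealSubfield L)) V ≃ₗ[AdeleRing (𝓞 ↥(maximalRealSubfield L)) ↥(maximalRealSubfield L)]
              AdelicSpace (↥(maximalRealSubfield L)) V) (e₀ c) =
        e₀ (((adelicMpCont.proj (↥(maximalRealSubfield L)) (Fin n)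
                (1 : Matrix (Fin n) (Fin n) (AdeleRing (𝓞 ↥(maximalRealSubfield L)) ↥(maximalRealSubfield L))) m₁ :
              symplecticGroup (polar (adelicForm (↥(maximalRealSubfield L)) (Fin n)
                (1 : Matrix (Fin n) (Fin n) (AdeleRing (𝓞 ↥(maximalRealSubfield L)) ↥(maximalRealSubfield L)))))) :
            ((Fin n → AdeleRing (𝓞 ↥(maximalRealSubfield L)) ↥(maximalRealSubfield L)) ×
                (Fin n → AdeleRing (𝓞 ↥(maximalRealSubfield L)) ↥(maximalRealSubfield L))) ≃ₗ[
                AdeleRing (𝓞 ↥(maximalRealSubfield L)) ↥(maximalRealSubfield L)]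
              ((Fin n → AdeleRing (𝓞 ↥(maximalRealSubfield L)) ↥(maximalRealSubfield L)) ×
                (Fin n → AdeleRing (𝓞 ↥(maximalRealSubfield L)) ↥(maximalRealSubfield L)))) c)) :
    (∃! i : ratSp (↥(maximalRealSubfield L)) L V Φ →* adelicMp (↥(maximalRealSubfield L)) L V Φ ρ,
        IsRationalSplitting (↥(maximalRealSubfield L)) L V Φ ρ i) ∧
      ∀ i : ratSp (↥(maximalRealSubfield L)) L V Φ →* adelicMp (↥(maximalRealSubfield L)) L V Φ ρ,
        IsRationalSplitting (↥(maximalRealSubfield L)) L V Φ ρ i →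
          ((∃ s : adelicUnitary (↥(maximalRealSubfield L)) L V Φ →* adelicMp (↥(maximalRealSubfield L)) L V Φ ρ,
              ∀ g : adelicUnitary (↥(maximalRealSubfield L)) L V Φ,
                projEnd (↥(maximalRealSubfield L)) L V Φ ρ (s g) =
                  ((g : AdelicSpace (↥(maximalRealSubfield L)) V ≃ₗ[AdeleRing (𝓞 ↥(maximalRealSubfield L)) ↥(maximalRealSubfield L)]
                      AdelicSpace (↥(maximalRealSubfield L)) V) :
                    AdelicSpace (↥(maximalRealSubfield L)) V →ₗ[AdeleRing (𝓞 ↥(maximalRealSubfield L)) ↥(maximalRealSubfield L)]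
                      AdelicSpace (↥(maximalRealSubfield L)) V)) ∧
            ∃ s : adelicUnitary (↥(maximalRealSubfield L)) L V Φ →* adelicMp (↥(maximalRealSubfield L)) L V Φ ρ,
              Continuous s ∧
              (∀ g : adelicUnitary (↥(maximalRealSubfield L)) L V Φ,
                projEnd (↥(maximalRealSubfield L)) L V Φ ρ (s g) =
                  ((g : AdelicSpace (↥(maximalRealSubfield L)) V ≃ₗ[AdeleRing (𝓞 ↥(maximalRealSubfield L)) ↥(maximalRealSubfield L)]
                      AdelicSpace (↥(maximalRealSubfield L)) V) :
                    AdelicSpace (↥(maximalRealSubfield L)) V →ₗ[AdeleRing (𝓞 ↥(maximalRealSubfield L)) ↥(maximalRealSubfield L)]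
                      AdelicSpace (↥(maximalRealSubfield L)) V)) ∧
              ∀ g : adelicUnitary (↥(maximalRealSubfield L)) L V Φ,
                IsRationalPoint (↥(maximalRealSubfield L)) L V Φ
                    (g : AdelicSpace (↥(maximalRealSubfield L)) V ≃ₗ[AdeleRing (𝓞 ↥(maximalRealSubfield L)) ↥(maximalRealSubfield L)]
                      AdelicSpace (↥(maximalRealSubfield L)) V) →
                  s g ∈ i.range) :=
  prop311_CM_of_darbouxLegs L V Φ ρ hn hΦ₁ hΦ₂ hΦ₃ hφ hρu hρi
    (darbouxLegs_of_darbouxLeg_of_proj_surjective (↥(maximalRealSubfield L)) L V Φ ρ n hsurj e₀ he₀ φ₀ hφ₀ hproj₀)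

end CM

end Prop311

end Literature.NumberTheory.GelbartRogawski1991

end
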